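import Literature.NumberTheory.LFunctions.WeilTwoPrimeOddMarginHBase
import Literature.NumberTheory.LFunctions.WeilTwoPrimeOddMarginHDataP22
import Literature.NumberTheory.LFunctions.WeilBlockRowsP
import HarnessLib

/-!
# Two-prime odd-margin certificate H: the materialized block agrees with `P_r`, rows 100–109

`WeilCert.checkPmRow` (row `k` of the claim `Pm_{kl} = P_r(2k+1, 2l+1)`) for certificate H, by `decide +kernel`. Pure proof file; nothing is asserted.
-/

noncomputable section

namespace Literature.NumberTheory.LFunctions

set_option maxHeartbeats 0 in
/-- Row 100 of the materialized block is row 100 of `P_r` (certificate H). [folklore] -/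
theorem checkPmRow1_100_weilCert23H : weilCert23HBase.checkPmRow weilCert23HNu weilCert23HPm 1 100 = true := by
  decide +kernel

set_option maxHeartbeats 0 in
/-- Row 101 of the materialized block is row 101 of `P_r` (certificate H). [folklore] -/
theorem checkPmRow1_101_weilCert23H : weilCert23HBase.checkPmRow weilCert23HNu weilCert23HPm 1 101 = true := by
  decide +kernel

set_option maxHeartbeats 0 in
/-- Row 102 of the materialized block is row 102 of `P_r` (certificate H). [folklore] -/
theorem checkPmRow1_102_weilCert23H : weilCert23HBase.checkPmRow weilCert23HNu weilCert23HPm 1 102 = true := by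
  decide +kernel

set_option maxHeartbeats 0 in
/-- Row 103 of the materialized block is row 103 of `P_r` (certificate H). [folklore] -/
theorem checkPmRow1_103_weilCert23H : weilCert23HBase.checkPmRow weilCert23HNu weilCert23HPm 1 103 = true := by
  decide +kernel

set_option maxHeartbeats 0 in
/-- Row 104 of the materialized block is row 104 of `P_r` (certificate H). [folklore] -/
theorem checkPmRow1_104_weilCert23H : weilCert23HBase.checkPmRow weilCert23HNu weilCert23HPm 1 104 = true := by
  decide +kernel

set_option maxHeartbeats 0 in
/-- Row 105 of the materialized block is row 105 of `P_r` (certificate H). [folklore] -/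
theorem checkPmRow1_105_weilCert23H : weilCert23HBase.checkPmRow weilCert23HNu weilCert23HPm 1 105 = true := by
  decide +kernel

set_option maxHeartbeats 0 in
/-- Row 106 of the materialized block is row 106 of `P_r` (certificate H). [folklore] -/
theorem checkPmRow1_106_weilCert23H : weilCert23HBase.checkPmRow weilCert23HNu weilCert23HPm 1 106 = true := by
  decide +kernel

set_option maxHeartbeats 0 in
/-- Row 107 of the materialized block is row 107 of `P_r` (certificate H). [folklore] -/
theorem checkPmRow1_107_weilCert23H : weilCert23HBase.checkPmRow weilCert23HNu weilCert23HPm 1 107 = true := by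
  decide +kernel

set_option maxHeartbeats 0 in
/-- Row 108 of the materialized block is row 108 of `P_r` (certificate H). [folklore] -/
theorem checkPmRow1_108_weilCert23H : weilCert23HBase.checkPmRow weilCert23HNu weilCert23HPm 1 108 = true := by
  decide +kernel

set_option maxHeartbeats 0 in
/-- Row 109 of the materialized block is row 109 of `P_r` (certificate H). [folklore] -/
theorem checkPmRow1_109_weilCert23H : weilCert23HBase.checkPmRow weilCert23HNu weilCert23HPm 1 109 = true := by
  decide +kernel


end Literature.NumberTheory.LFunctions
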